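import Summits.BirchSwinnertonDyer.Rank1Residual.X5.SelmerSolitaireAlternating
import Summits.BirchSwinnertonDyer.Rank1Residual.X5.SelmerSolitairePivotAux
import HarnessLib

/-!
# X5 / O1 (p = 2), lens-2 "Selmer solitaire": two-point Schur complements and the peeling lemma for
# alternating matrices over `𝔽₂`, in KERNEL-VECTOR form (the generic layer of T4 = stub₂′)

HONEST FRAMING (cell `b2b-bsdres`, run/shared/lean/b2b/bsd-rank1-residual/, verbatim in every
file): the goal of the cell is to DELETE the COMBINATION-SHAPED residual classes of the
Birch–Swinnerton-Dyer formula for ALL analytic-rank `≤ 1` elliptic curves over `ℚ` — assembled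
STRICTLY from published theorems — so that the rank-`≤ 1` remainder becomes exactly the
CONSTRUCTION-SHAPED classes, which are TYPED (missing-input `Prop`s), NOT attempted. This is not
"finishing BSD". Cell O1 (`p = 2`): research route; O1 OPEN; nothing booked; no mark / label / count
moved. THEOREMS ONLY (no definition, no named fact, no `sorry`); reach-neutral linear algebra over
`ZMod 2` on a bare `Matrix ι ι (ZMod 2)`; nothing arithmetic is asserted.

WHAT THIS FILE IS. o1 PROVER ORDER v2.8 (ii′), second hand (x11b3-p2, split agreed with the
holder x11b3-p4): the generic lemmas behind the STRONG one-prime connection theorem T4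
(`onePrimeConnection_strong`, next file), phrased — like x11b3-p4's `det_submatrix_eq_zero_iff`
(`X5/SelmerSolitairePivotAux.lean`), on which they rest — with vectors on the AMBIENT index type
`ι` supported on a finset, never with block matrices:

* §1 plumbing: `mulVec_single_apply'`, `mulVec_zeroExtend_apply`, **`exists_solution`** (K): if
  `det S[X] ≠ 0` then every target `t` has a `κ` supported on `X` with `(S κ)ᵢ = tᵢ` on `X`
  (`κ := S[X]⁻¹ t|_X` extended by zero); `eq_zero_of_supported_of_killed`.
* §2 the alternating trick in solution form (`S` symmetric, zero diagonal):
  `sum_solution_mul_target` (`κ ⬝ Sκ = ∑_{i∈X} κᵢ tᵢ = 0`), **`solution_apply_self`**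
  (`(S κᵃ)ₐ = 0`), **`schur_symm`** / `sum_solution_symm` (the two-point Schur complement
  `σ_X(a,q) = S_{qa} + (Sκᵃ)_q` is symmetric).
* §3 **`det_insert_insert_eq_zero_iff`** (SC2): for `a ≠ q` outside `X` with `det S[X] ≠ 0`:
  `det S[X ∪ {a,q}] = 0 ⟺ σ_X(a,q) = 0` (the Schur complement of `S[X]` is `[[0,σ],[σ,0]]`,
  read through kernel vectors); `…_ne_zero_iff`, `…_eq_one_iff`.
* §4 **`exists_erase_erase_det_ne_zero`** (PEEL): `det S[Y] ≠ 0`, `u ∈ Y` ⟹ some `v ∈ Y`,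
  `v ≠ u`, has `det S[Y ∖ {u,v}] ≠ 0` — lens-2 G5.3 Step 2 ('Jacobi chain'), both parities.

References: lens-2 GEN 5 addendum G5.3 (T4), G5.10 — `HOME/b2b-bsdres-o1-idea-2-g5/`; plan check
`HOME/b2b-bsdres-x11b3-p2/o1/plan_check.py` (every lemma here and the induction they serve
verified exhaustively for `s ≤ 4`; EVIDENCE only).
-/

namespace Summit.BirchSwinnertonDyer.Rank1Residual.X5.SelmerSolitaire.Alt

open Matrix Finset

variable {ι : Type*} [Fintype ι] [DecidableEq ι]

/-! ### §1 Plumbing: supported vectors, solutions of the `X`-system -/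

/-- `(S eₐ·c)ᵢ = Sᵢₐ c`. [folklore] -/
theorem mulVec_single_apply' (S : Matrix ι ι (ZMod 2)) (a : ι) (c : ZMod 2) (i : ι) :
    (S *ᵥ Pi.single a c) i = S i a * c := by
  simp only [Matrix.mulVec, dotProduct, Pi.single_apply, mul_ite, mul_zero]
  rw [Finset.sum_ite_eq' Finset.univ a]
  simp

/-- A zero-extended vector times `S`, read at a point of the finset, is the principal submatrix
times the vector. [folklore] -/
theorem mulVec_zeroExtend_apply (S : Matrix ι ι (ZMod 2)) (X : Finset ι) (v : ↥X → ZMod 2)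
    (k : ↥X) :
    (S *ᵥ fun i => if h : i ∈ X then v ⟨i, h⟩ else 0) (k : ι) =
      (S.submatrix (Subtype.val : ↥X → ι) Subtype.val *ᵥ v) k := by
  simp only [Matrix.mulVec, dotProduct, Matrix.submatrix_apply]
  rw [← Finset.sum_add_sum_compl X, ← Finset.sum_coe_sort X]
  have h0 : ∑ i ∈ Xᶜ, S k i * (fun i => if h : i ∈ X then v ⟨i, h⟩ else 0) i = 0 :=
    Finset.sum_eq_zero fun i hi => by
      rw [Finset.mem_compl] at hi
      simp [hi]
  rw [h0, add_zero]
  refine Finset.sum_congr rfl fun j _ => ?_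
  simp [j.2]

/-- **(K) Solutions of the `X`-system exist when `S[X]` is nonsingular**: for every target `t` there
is `κ` supported on `X` with `(S κ)ᵢ = tᵢ` for all `i ∈ X` (take `κ = S[X]⁻¹ (t|_X)` extended by
zero). [folklore] -/
theorem exists_solution (S : Matrix ι ι (ZMod 2)) (X : Finset ι)
    (hX : (S.submatrix (Subtype.val : ↥X → ι) Subtype.val).det ≠ 0) (t : ι → ZMod 2) :
    ∃ κ : ι → ZMod 2, (∀ i, i ∉ X → κ i = 0) ∧ ∀ i ∈ X, (S *ᵥ κ) i = t i := by
  set A := S.submatrix (Subtype.val : ↥X → ι) Subtype.val with hA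
  have hu : IsUnit A.det := isUnit_iff_ne_zero.mpr hX
  set v : ↥X → ZMod 2 := A⁻¹ *ᵥ fun k => t k with hv
  refine ⟨fun i => if h : i ∈ X then v ⟨i, h⟩ else 0, fun i hi => by simp [hi], fun i hi => ?_⟩
  have h := mulVec_zeroExtend_apply S X v ⟨i, hi⟩
  rw [h, ← hA, hv, Matrix.mulVec_mulVec, Matrix.mul_nonsing_inv A hu, Matrix.one_mulVec]

/-- The nonsingular half of `det_submatrix_eq_zero_iff` as an implication: a vector supported on
`X` and killed by `S` on `X` vanishes when `det S[X] ≠ 0`. [folklore] -/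
theorem eq_zero_of_supported_of_killed (S : Matrix ι ι (ZMod 2)) (X : Finset ι)
    (hX : (S.submatrix (Subtype.val : ↥X → ι) Subtype.val).det ≠ 0) {y : ι → ZMod 2}
    (hyX : ∀ i, i ∉ X → y i = 0) (hy : ∀ i ∈ X, (S *ᵥ y) i = 0) : y = 0 := by
  by_contra h
  exact hX ((det_submatrix_eq_zero_iff S X).mpr ⟨y, h, hyX, hy⟩)

/-! ### §2 The alternating trick in solution form -/

section Alternating

variable {S : Matrix ι ι (ZMod 2)}

/-- For `κ` supported on `X` solving `(Sκ)ᵢ = tᵢ` on `X`: `∑ᵢ κᵢ tᵢ = 0` (it is `κ ⬝ Sκ`, which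
vanishes for an alternating `S`). [folklore] -/
theorem sum_solution_mul_target (hS : S.IsSymm) (hd : ∀ i, S i i = 0) {X : Finset ι}
    {κ t : ι → ZMod 2}
    (hκX : ∀ i, i ∉ X → κ i = 0) (hκ : ∀ i ∈ X, (S *ᵥ κ) i = t i) :
    ∑ i, κ i * t i = 0 := by
  have h0 := quadForm_eq_zero hS hd κ
  rw [dotProduct] at h0
  rw [← h0]
  refine Finset.sum_congr rfl fun i _ => ?_
  by_cases hi : i ∈ X
  · rw [hκ i hi]
  · rw [hκX i hi, zero_mul, zero_mul]

/-- **`(S κᵃ)ₐ = 0`** for a solution `κᵃ` (supported on `X`) of the column-`a` system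
`(S κᵃ)ᵢ = Sᵢₐ` (`i ∈ X`) — the diagonal of the two-point Schur complement vanishes. [folklore] -/
theorem solution_apply_self (hS : S.IsSymm) (hd : ∀ i, S i i = 0) {X : Finset ι} {a : ι}
    {κ : ι → ZMod 2}
    (hκX : ∀ i, i ∉ X → κ i = 0) (hκ : ∀ i ∈ X, (S *ᵥ κ) i = S i a) : (S *ᵥ κ) a = 0 := by
  have h := sum_solution_mul_target hS hd hκX hκ
  simp only [Matrix.mulVec, dotProduct]
  rw [← h]
  refine Finset.sum_congr rfl fun i _ => ?_
  rw [hS.apply i a, mul_comm]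

/-- **Symmetry of the two-point Schur complement**: for solutions `κᵃ`, `κ^q` of the column-`a` and
column-`q` systems on `X`, `S_{qa} + (S κᵃ)_q = S_{aq} + (S κ^q)ₐ`. [folklore] -/
theorem schur_symm (hS : S.IsSymm) {X : Finset ι} {a q : ι} {κa κq : ι → ZMod 2}
    (haX : ∀ i, i ∉ X → κa i = 0) (ha : ∀ i ∈ X, (S *ᵥ κa) i = S i a)
    (hqX : ∀ i, i ∉ X → κq i = 0) (hq : ∀ i ∈ X, (S *ᵥ κq) i = S i q) :
    S q a + (S *ᵥ κa) q = S a q + (S *ᵥ κq) a := by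
  have hvec : ∀ v : ι → ZMod 2, v ᵥ* S = S *ᵥ v := fun v => by
    conv_lhs => rw [← hS.eq]
    exact Matrix.vecMul_transpose S v
  have hsym : κq ⬝ᵥ (S *ᵥ κa) = κa ⬝ᵥ (S *ᵥ κq) := by
    rw [Matrix.dotProduct_mulVec, hvec, dotProduct_comm]
  -- `(Sκᵃ)_q = κᵃ ⬝ Sκ^q` and `(Sκ^q)ₐ = κ^q ⬝ Sκᵃ`
  have h1 : (S *ᵥ κa) q = κa ⬝ᵥ (S *ᵥ κq) := by
    rw [dotProduct]
    simp only [Matrix.mulVec, dotProduct]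
    refine Finset.sum_congr rfl fun j _ => ?_
    by_cases hj : j ∈ X
    · have := hq j hj
      simp only [Matrix.mulVec, dotProduct] at this
      rw [this, hS.apply j q, mul_comm]
    · rw [haX j hj, mul_zero, zero_mul]
  have h2 : (S *ᵥ κq) a = κq ⬝ᵥ (S *ᵥ κa) := by
    rw [dotProduct]
    simp only [Matrix.mulVec, dotProduct]
    refine Finset.sum_congr rfl fun j _ => ?_
    by_cases hj : j ∈ X
    · have := ha j hj
      simp only [Matrix.mulVec, dotProduct] at this
      rw [this, hS.apply j a, mul_comm]
    · rw [hqX j hj, mul_zero, zero_mul]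
  rw [h1, h2, hsym, hS.apply q a]

/-- Bilinear symmetry for two solutions with arbitrary targets: `∑ᵢ κᵢ t'ᵢ = ∑ᵢ κ'ᵢ tᵢ`
(`κ ⬝ Sκ' = κ' ⬝ Sκ`). [folklore] -/
theorem sum_solution_symm (hS : S.IsSymm) {X : Finset ι} {κ κ' t t' : ι → ZMod 2}
    (hκX : ∀ i, i ∉ X → κ i = 0) (hκ : ∀ i ∈ X, (S *ᵥ κ) i = t i)
    (hκ'X : ∀ i, i ∉ X → κ' i = 0) (hκ' : ∀ i ∈ X, (S *ᵥ κ') i = t' i) :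
    ∑ i, κ i * t' i = ∑ i, κ' i * t i := by
  have hvec : ∀ v : ι → ZMod 2, v ᵥ* S = S *ᵥ v := fun v => by
    conv_lhs => rw [← hS.eq]
    exact Matrix.vecMul_transpose S v
  have hsym : κ ⬝ᵥ (S *ᵥ κ') = κ' ⬝ᵥ (S *ᵥ κ) := by
    rw [Matrix.dotProduct_mulVec, hvec, dotProduct_comm]
  have h1 : κ ⬝ᵥ (S *ᵥ κ') = ∑ i, κ i * t' i := by
    rw [dotProduct]
    refine Finset.sum_congr rfl fun i _ => ?_
    by_cases hi : i ∈ X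
    · rw [hκ' i hi]
    · rw [hκX i hi, zero_mul, zero_mul]
  have h2 : κ' ⬝ᵥ (S *ᵥ κ) = ∑ i, κ' i * t i := by
    rw [dotProduct]
    refine Finset.sum_congr rfl fun i _ => ?_
    by_cases hi : i ∈ X
    · rw [hκ i hi]
    · rw [hκ'X i hi, zero_mul, zero_mul]
  rw [← h1, ← h2, hsym]

/-! ### §3 The two-point Schur complement through kernel vectors (SC2) -/

/-- **(SC2)** For `a ≠ q` outside `X`, `det S[X] ≠ 0` and solutions `κᵃ, κ^q` of the two column
systems: **`det S[X ∪ {a, q}] = 0 ⟺ S_{qa} + (S κᵃ)_q = 0`**. (The Schur complement of `S[X]` in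
`S[X ∪ {a,q}]` is `[[0, σ], [σ, 0]]` with `σ = S_{qa} + (Sκᵃ)_q`; read through kernel vectors: if
`σ = 0` then `κᵃ + eₐ` is a kernel vector, and if `σ ≠ 0` a kernel vector `z` has
`z|_X = zₐ κᵃ + z_q κ^q` and rows `q`, `a` give `zₐ σ = z_q σ = 0`.) [folklore] -/
theorem det_insert_insert_eq_zero_iff (hS : S.IsSymm) (hd : ∀ i, S i i = 0) {X : Finset ι}
    {a q : ι} (haX : a ∉ X) (hqX : q ∉ X)
    (haq : a ≠ q) (hX : (S.submatrix (Subtype.val : ↥X → ι) Subtype.val).det ≠ 0)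
    {κa κq : ι → ZMod 2} (hκaX : ∀ i, i ∉ X → κa i = 0) (hκa : ∀ i ∈ X, (S *ᵥ κa) i = S i a)
    (hκqX : ∀ i, i ∉ X → κq i = 0) (hκq : ∀ i ∈ X, (S *ᵥ κq) i = S i q) :
    (S.submatrix (Subtype.val : ↥(insert a (insert q X)) → ι) Subtype.val).det = 0 ↔
      S q a + (S *ᵥ κa) q = 0 := by
  have hself_a : (S *ᵥ κa) a = 0 := solution_apply_self hS hd hκaX hκa
  have hself_q : (S *ᵥ κq) q = 0 := solution_apply_self hS hd hκqX hκq
  have hsymm : S q a + (S *ᵥ κa) q = S a q + (S *ᵥ κq) a := schur_symm hS hκaX hκa hκqX hκq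
  constructor
  · -- a kernel vector `z` forces `σ = 0` unless it vanishes
    intro hdet
    obtain ⟨z, hz0, hzY, hz⟩ := (det_submatrix_eq_zero_iff S _).mp hdet
    by_contra hσ
    -- decomposition of `z` along `X ⊔ {a} ⊔ {q}`
    set zX : ι → ZMod 2 := fun i => if i ∈ X then z i else 0 with hzX
    have hdecomp : z = zX + z a • Pi.single a 1 + z q • Pi.single q 1 := by
      funext i
      simp only [Pi.add_apply, Pi.smul_apply, smul_eq_mul, hzX, Pi.single_apply]
      by_cases hiX : i ∈ X
      · have hia : i ≠ a := fun h => haX (h ▸ hiX)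
        have hiq : i ≠ q := fun h => hqX (h ▸ hiX)
        simp [hiX, hia, hiq]
      · by_cases hia : i = a
        · subst hia
          simp [hiX, haq]
        · by_cases hiq : i = q
          · subst hiq
            simp [hiX, hia]
          · have hiY : i ∉ insert a (insert q X) := by simp [hia, hiq, hiX]
            simp [hiX, hia, hiq, hzY i hiY]
    -- the vector `y = z_X + zₐ κᵃ + z_q κ^q` is supported on `X` and killed on `X`, hence zero
    set y : ι → ZMod 2 := zX + z a • κa + z q • κq with hy
    have hyX : ∀ i, i ∉ X → y i = 0 := fun i hi => by
      simp [hy, hzX, hi, hκaX i hi, hκqX i hi]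
    have hSz : ∀ i, (S *ᵥ z) i = (S *ᵥ zX) i + z a * S i a + z q * S i q := fun i => by
      conv_lhs => rw [hdecomp]
      simp only [Matrix.mulVec_add, Matrix.mulVec_smul, Pi.add_apply, Pi.smul_apply, smul_eq_mul,
        mulVec_single_apply', mul_one]
    have hSy : ∀ i, (S *ᵥ y) i = (S *ᵥ zX) i + z a * (S *ᵥ κa) i + z q * (S *ᵥ κq) i := fun i => by
      simp only [hy, Matrix.mulVec_add, Matrix.mulVec_smul, Pi.add_apply, Pi.smul_apply, smul_eq_mul]
    have hy0 : y = 0 := by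
      refine eq_zero_of_supported_of_killed S X hX hyX fun i hi => ?_
      rw [hSy, hκa i hi, hκq i hi, ← hSz]
      exact hz i (by simp [hi])
    -- hence `z|_X = zₐ κᵃ + z_q κ^q`, i.e. `z = zₐ (κᵃ + eₐ) + z_q (κ^q + e_q)`
    have hzX_eq : zX = z a • κa + z q • κq := by
      funext i
      have h := congrFun hy0 i
      simp only [hy, Pi.add_apply, Pi.smul_apply, smul_eq_mul, Pi.zero_apply] at h
      rw [add_assoc, ← CharTwo.sub_eq_add, sub_eq_zero] at h
      simpa [Pi.add_apply, smul_eq_mul] using h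
    have hz_eq : z = z a • κa + z q • κq + z a • Pi.single a 1 + z q • Pi.single q 1 := by
      rw [← hzX_eq]; exact hdecomp
    have hSz' : ∀ i, (S *ᵥ z) i =
        z a * (S *ᵥ κa) i + z q * (S *ᵥ κq) i + z a * S i a + z q * S i q := fun i => by
      conv_lhs => rw [hz_eq]
      simp only [Matrix.mulVec_add, Matrix.mulVec_smul, Pi.add_apply, Pi.smul_apply, smul_eq_mul,
        mulVec_single_apply', mul_one]
    -- row `q`: `zₐ σ = 0`; row `a`: `z_q σ = 0`
    have hrow_q := hz q (by simp)
    rw [hSz', hself_q, hd q] at hrow_q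
    have hza : z a = 0 := by
      have h : z a * (S q a + (S *ᵥ κa) q) = 0 := by
        rw [← hrow_q]; ring
      rcases mul_eq_zero.mp h with h | h
      · exact h
      · exact absurd h hσ
    have hrow_a := hz a (by simp)
    rw [hSz', hself_a, hd a] at hrow_a
    have hzq : z q = 0 := by
      have h : z q * (S a q + (S *ᵥ κq) a) = 0 := by
        rw [← hrow_a]; ring
      rw [← hsymm] at h
      rcases mul_eq_zero.mp h with h | h
      · exact h
      · exact absurd h hσ
    apply hz0
    rw [hz_eq, hza, hzq]
    simp
  · -- `σ = 0`: `κᵃ + eₐ` is a kernel vector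
    intro hσ
    refine (det_submatrix_eq_zero_iff S _).mpr ⟨κa + Pi.single a 1, ?_, ?_, ?_⟩
    · intro h
      have := congrFun h a
      rw [Pi.add_apply, Pi.single_eq_same, hκaX a haX, zero_add] at this
      exact one_ne_zero this
    · intro i hi
      simp only [Finset.mem_insert, not_or] at hi
      rw [Pi.add_apply, hκaX i hi.2.2, Pi.single_eq_of_ne hi.1, zero_add]
    · intro i hi
      rw [Matrix.mulVec_add, Pi.add_apply, mulVec_single_apply', mul_one]
      simp only [Finset.mem_insert] at hi
      rcases hi with rfl | rfl | hi
      · rw [hself_a, hd, zero_add]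
      · rw [add_comm]; exact hσ
      · rw [hκa i hi]; exact CharTwo.add_self_eq_zero _

/-- (SC2), nonsingular spelling: `det S[X ∪ {a,q}] ≠ 0 ⟺ S_{qa} + (Sκᵃ)_q ≠ 0`. [folklore] -/
theorem det_insert_insert_ne_zero_iff (hS : S.IsSymm) (hd : ∀ i, S i i = 0) {X : Finset ι}
    {a q : ι} (haX : a ∉ X) (hqX : q ∉ X)
    (haq : a ≠ q) (hX : (S.submatrix (Subtype.val : ↥X → ι) Subtype.val).det ≠ 0)
    {κa κq : ι → ZMod 2} (hκaX : ∀ i, i ∉ X → κa i = 0) (hκa : ∀ i ∈ X, (S *ᵥ κa) i = S i a)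
    (hκqX : ∀ i, i ∉ X → κq i = 0) (hκq : ∀ i ∈ X, (S *ᵥ κq) i = S i q) :
    (S.submatrix (Subtype.val : ↥(insert a (insert q X)) → ι) Subtype.val).det ≠ 0 ↔
      S q a + (S *ᵥ κa) q ≠ 0 :=
  (det_insert_insert_eq_zero_iff hS hd haX hqX haq hX hκaX hκa hκqX hκq).not

/-- (SC2), `det = 1` spelling over `𝔽₂`: `det S[X ∪ {a,q}] = 1 ⟺ S_{qa} + (Sκᵃ)_q = 1`. [folklore] -/
theorem det_insert_insert_eq_one_iff (hS : S.IsSymm) (hd : ∀ i, S i i = 0) {X : Finset ι}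
    {a q : ι} (haX : a ∉ X) (hqX : q ∉ X)
    (haq : a ≠ q) (hX : (S.submatrix (Subtype.val : ↥X → ι) Subtype.val).det ≠ 0)
    {κa κq : ι → ZMod 2} (hκaX : ∀ i, i ∉ X → κa i = 0) (hκa : ∀ i ∈ X, (S *ᵥ κa) i = S i a)
    (hκqX : ∀ i, i ∉ X → κq i = 0) (hκq : ∀ i ∈ X, (S *ᵥ κq) i = S i q) :
    (S.submatrix (Subtype.val : ↥(insert a (insert q X)) → ι) Subtype.val).det = 1 ↔
      S q a + (S *ᵥ κa) q = 1 := by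
  rw [eq_one_iff_ne_zero, eq_one_iff_ne_zero]
  exact det_insert_insert_ne_zero_iff hS hd haX hqX haq hX hκaX hκa hκqX hκq

/-! ### §4 The peeling lemma (PEEL): a nonsingular `S[Y]` has a nonsingular `S[Y ∖ {u,v}]` -/

/-- **(PEEL)** If `det S[Y] ≠ 0` and `u ∈ Y` then some `v ∈ Y`, `v ≠ u`, has `det S[Y ∖ {u,v}] ≠ 0`.
Proof: let `c` solve `(S c)ᵢ = δᵢᵤ` on `Y` (the row `u` of `S[Y]⁻¹`); `c_u = c ⬝ Sc = 0` and `c ≠ 0`,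
so `c_v ≠ 0` for some `v ∈ Y ∖ {u}`; a kernel vector `z` of `S[Y ∖ {u,v}]` would give the vector
`z + (Sz)ᵤ c + (Sz)ᵥ c'` (`c'` the column-`v` analogue, `c'_u = c_v`) supported on `Y` and killed on
`Y`, hence zero, whence `(Sz)ᵤ = (Sz)ᵥ = 0` and `z = 0`. This is the 'Jacobi chain' step of lens-2
G5.3 (both parities at once). [folklore] -/
theorem exists_erase_erase_det_ne_zero (hS : S.IsSymm) (hd : ∀ i, S i i = 0) {Y : Finset ι}
    (hY : (S.submatrix (Subtype.val : ↥Y → ι) Subtype.val).det ≠ 0) {u : ι} (hu : u ∈ Y) :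
    ∃ v ∈ Y, v ≠ u ∧
      (S.submatrix (Subtype.val : ↥((Y.erase u).erase v) → ι) Subtype.val).det ≠ 0 := by
  -- the solution `c` of the column system for `eᵤ`
  obtain ⟨c, hcY, hc⟩ := exists_solution S Y hY (Pi.single u 1)
  have hdiag : ∀ {w : ι} {e : ι → ZMod 2}, (∀ i, i ∉ Y → e i = 0) →
      (∀ i ∈ Y, (S *ᵥ e) i = (Pi.single w 1 : ι → ZMod 2) i) → e w = 0 := by
    intro w e heY he
    have h := sum_solution_mul_target hS hd heY he
    simpa [Pi.single_apply, Finset.sum_ite_eq'] using h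
  have hcu : c u = 0 := hdiag hcY hc
  have hc0 : c ≠ 0 := by
    intro h
    have := hc u hu
    rw [h, Matrix.mulVec_zero, Pi.zero_apply, Pi.single_eq_same] at this
    exact zero_ne_one this
  obtain ⟨v, hcv⟩ := Function.ne_iff.mp hc0
  rw [Pi.zero_apply] at hcv
  have hvY : v ∈ Y := by
    by_contra h
    exact hcv (hcY v h)
  have hvu : v ≠ u := by
    rintro rfl
    exact hcv hcu
  refine ⟨v, hvY, hvu, ?_⟩
  intro hdet
  obtain ⟨z, hz0, hzY, hz⟩ := (det_submatrix_eq_zero_iff S _).mp hdet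
  -- the column-`v` analogue `c'`, with `c'_v = 0` and `c'_u = c_v`
  obtain ⟨c', hc'Y, hc'⟩ := exists_solution S Y hY (Pi.single v 1)
  have hc'v : c' v = 0 := hdiag hc'Y hc'
  have hc'u : c' u = c v := by
    have h := sum_solution_symm hS hcY hc hc'Y hc'
    simpa [Pi.single_apply, Finset.sum_ite_eq'] using h.symm
  -- `y = z + (Sz)ᵤ c + (Sz)ᵥ c'` is supported on `Y` and killed on `Y`
  set ru := (S *ᵥ z) u with hru
  set rv := (S *ᵥ z) v with hrv
  set y : ι → ZMod 2 := z + ru • c + rv • c' with hy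
  have hzY' : ∀ i, i ∉ Y → z i = 0 := fun i hi =>
    hzY i (fun h => hi (Finset.mem_of_mem_erase (Finset.mem_of_mem_erase h)))
  have hyY : ∀ i, i ∉ Y → y i = 0 := fun i hi => by
    simp [hy, hzY' i hi, hcY i hi, hc'Y i hi]
  have hSy : ∀ i, (S *ᵥ y) i = (S *ᵥ z) i + ru * (S *ᵥ c) i + rv * (S *ᵥ c') i := fun i => by
    simp only [hy, Matrix.mulVec_add, Matrix.mulVec_smul, Pi.add_apply, Pi.smul_apply, smul_eq_mul]
  have hy0 : y = 0 := by
    refine eq_zero_of_supported_of_killed S Y hY hyY fun i hi => ?_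
    rw [hSy, hc i hi, hc' i hi]
    by_cases hiu : i = u
    · subst hiu
      rw [Pi.single_eq_same, Pi.single_eq_of_ne hvu.symm, ← hru]
      simp [CharTwo.add_self_eq_zero]
    · by_cases hiv : i = v
      · subst hiv
        rw [Pi.single_eq_same, Pi.single_eq_of_ne hiu, ← hrv]
        simp [CharTwo.add_self_eq_zero]
      · rw [Pi.single_eq_of_ne hiu, Pi.single_eq_of_ne hiv, mul_zero, mul_zero, add_zero, add_zero]
        exact hz i (by simp [hiu, hiv, hi])
  -- read `y = 0` at `u` and at `v`
  have hzu : z u = 0 := hzY u (by simp)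
  have hzv : z v = 0 := hzY v (by simp [hvu])
  have hyu := congrFun hy0 u
  have hyv := congrFun hy0 v
  simp only [hy, Pi.add_apply, Pi.smul_apply, smul_eq_mul, Pi.zero_apply, hzu, hcu, hc'u,
    mul_zero, zero_add] at hyu
  simp only [hy, Pi.add_apply, Pi.smul_apply, smul_eq_mul, Pi.zero_apply, hzv, hc'v, mul_zero,
    add_zero, zero_add] at hyv
  have hrv0 : rv = 0 := by
    rcases mul_eq_zero.mp hyu with h | h
    · exact h
    · exact absurd h hcv
  have hru0 : ru = 0 := by
    rcases mul_eq_zero.mp hyv with h | h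
    · exact h
    · exact absurd h hcv
  apply hz0
  have : y = z := by simp [hy, hru0, hrv0]
  rw [← this, hy0]


end Alternating

end Summit.BirchSwinnertonDyer.Rank1Residual.X5.SelmerSolitaire.Alt
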